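import Literature.Analysis.FluidPDE.EulerBilinearSymbol
import HarnessLib

/-!
# Discharge: the Euler bilinear operator is an averaged Euler bilinear operator

Sibling proof file of `TaoAveragedEuler.lean` (D-0014: named facts `def X : Prop` are discharged
as `theorem X_holds : X`; everything here is **proved**, no definitions, no notation; the
sibling `TaoAveragedEulerProofs.lean` holds the discharges of `lerayProjFun_eq_self_of_isDivFree`
and `hasCancellation_eulerBilinear`). It discharges

* `Literature.Analysis.FluidPDE.exists_taoAverageData_op_eq_eulerBilinear_holds :
  exists_taoAverageData_op_eq_eulerBilinear` — there is an averaging datum `𝒜` (Tao 2016,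
  §1.1: random order-`0` multipliers `mᵢ(D)`, rotations `Rᵢ`, dilations `λᵢ`) whose averaged
  operator `𝒜.op u v = 𝔼[A₃† B(A₁u, A₂v)]` is the Euler bilinear operator
  `B(u,v) = -½ P[(u·∇)v + (v·∇)u]` (Tao (1.8)) on all Schwartz divergence-free `u v : ℝ³ → ℝ³`.

## Source

T. Tao, *Finite time blowup for an averaged three-dimensional Navier–Stokes equation*,
J. Amer. Math. Soc. 29 (2016), 601–674 = arXiv:1402.0290v3 (held as `paper:arxiv-1402.0290`),
§1.1, p. 6 of the held text: the averaged Euler bilinear operator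
`⟨B̃(u,v), w⟩ := 𝔼⟨B(m₁(D)Rot_{R₁}Dil_{λ₁}u, m₂(D)Rot_{R₂}Dil_{λ₂}v), m₃(D)Rot_{R₃}Dil_{λ₃}w⟩`
((1.12) there; (1.10) in the numbering of `TaoAveragedEuler.lean`). With the deterministic datum
`mᵢ ≡ 1`, `Rᵢ = 1`, `λᵢ = 1` on a one-point probability space this is `B` itself — immediate in
the paper, where `1(D) = id` on `H¹⁰_df`. In the tree's function-level formalisation
`1(D)u = Re 𝓕⁻𝓕 uℂ` (`multiplierApply`) is `u` exactly for `u ∈ L¹ ∩ C⁰` with `𝓕 uℂ ∈ L¹`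
(`multiplierApply_one`), so the discharge needs **`B(u,v) ∈ L¹ ∩ C⁰` with `𝓕 B(u,v)ℂ ∈ L¹`**
for Schwartz divergence-free `u v`; since `B(u,v) = -½ Re 𝓕⁻[P̂ ŵ]`, `w = (u·∇)v + (v·∇)u`, and
the kernel of `ξ ⊗ ξ/|ξ|²` on `div (u ⊗ v + v ⊗ u)` decays only like `|x|^{-d-1}`, this is the
integrability of third-order Riesz-type multipliers of Schwartz functions
(`HeatSubordinatedRiesz.lean`, by heat-semigroup subordination) applied to the representation
`P̂ ŵ = ŵ + ∑ₖ M_k e_k` of `EulerBilinearSymbol.lean`.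

## Contents (proof architecture as formalised)

* Reality: `fourierVec_neg_apply`, `leraySymbolC_fourierVec_neg` (`P̂(-ξ)ŵ(-ξ) = conj P̂(ξ)ŵ(ξ)`
  for a real field `w`), `conj_fourierInv_apply_coord`, `complexify_realPart_fourierInv`
  (a Hermitian integrable symbol has a real kernel, so `(Re 𝓕⁻G)ℂ = 𝓕⁻G`).
* `leray_fourierVec_convect_regular` — for divergence-free Schwartz `U V`, `w = (U·∇)V + (V·∇)U`
  and `G = P̂ ŵ`: `w ∈ L¹`, `G ∈ L¹`, `G` continuous off `0`, and
  **`𝓕⁻G = wℂ + ∑ₖ (𝓕⁻M_k) e_k ∈ L¹ ∩ C⁰`** (`exists_leraySymbolC_fourier_repr`,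
  `integrable_fourierInv_fourier_sum_lineDeriv₃_div_normSq`).
* `eulerBilinear_regular` — **`B(u,v)` is continuous, integrable, and `𝓕 B(u,v)ℂ ∈ L¹`**
  (`Bℂ = -½ 𝓕⁻G` by reality; `𝓕𝓕⁻G = G` a.e. by Fourier inversion at the continuity points
  `ξ ≠ 0`); hence `multiplierApply_one_eulerBilinear` (`1(D)B(u,v) = B(u,v)`) and
  `multiplierApply_one_of_isSchwartzField` (`1(D)u = u`).
* `isOrderZeroSymbol_one`; `exists_trivial_taoAverageData` — the datum `Ω = Unit`, `ℙ = δ`,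
  `σ = 3/2`, `mᵢ ≡ 1`, `Rᵢ = refl`, `λᵢ = 1` has `𝒜.op u v = 1(D) B(1(D)u, 1(D)v)`
  (`integral_dirac`, `Dil_1 = Rot_1 = id`, `1^{2σ-3} = 1`); and the discharge
  `exists_taoAverageData_op_eq_eulerBilinear_holds`.

## Mathlib / tree search

Mathlib: `Circle.starRingEnd_addChar` (`conj 𝐞(t) = 𝐞(-t)`),
`MeasureTheory.Integrable.fourier_fourierInv_eq`, `Continuous.fourierInv_fourier_eq`,
`Real.fourierInv_eq_fourier_neg`, `VectorFourier.fourierIntegral_const_smul`,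
`VectorFourier.fourierIntegral_add`, `integral_conj`, `integral_neg_eq_self`,
`Isometry.comp_continuous_iff`, `integral_dirac`, `iteratedFDeriv_const_of_ne`. Tree:
`multiplierApply_one`, `fourierVec`, `lerayProjFun`, `eulerBilinear`, `realPart`, `leraySymbolC`,
`TaoAverageData` (`TaoAveragedEuler`), `integrable_fourierInv_fourier_sum_lineDeriv₃_div_normSq`,
`fourierInv_finset_sum` (`HeatSubordinatedRiesz`), `exists_leraySymbolC_fourier_repr`,
`fourier_apply_coord` (`EulerBilinearSymbol`).

## References

* T. Tao, J. Amer. Math. Soc. 29 (2016), 601–674 = arXiv:1402.0290v3, §1.1, (1.8)–(1.12).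
  [`Tao2016`]
* P. G. Lemarié-Rieusset, *Recent developments in the Navier–Stokes problem* (2002), Ch. 11.
  [`LemarieRieusset2002`]
-/

noncomputable section

open MeasureTheory Filter Topology Set Complex
open scoped Real ENNReal NNReal FourierTransform RealInnerProductSpace SchwartzMap LineDeriv
  ComplexConjugate

namespace Literature.Analysis.FluidPDE

variable {ι : Type*} [Fintype ι]

/-! ### Reality: conjugation symmetry of the symbol -/

section Reality

/-- **The Fourier transform of a real field is Hermitian**: `û(-ξ)ᵢ = conj û(ξ)ᵢ` for an
integrable real vector field `u` (Tao 2016, §1.1: "real" symbols `m(-ξ) = \overline{m(ξ)}`).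
[folklore] -/
theorem fourierVec_neg_apply {u : EuclideanSpace ℝ ι → EuclideanSpace ℝ ι} (hu : Integrable u)
    (ξ : EuclideanSpace ℝ ι) (i : ι) :
    fourierVec u (-ξ) i = conj (fourierVec u ξ i) := by
  have hci : Integrable (FunctionSpaces.EuclideanSpace.complexify ∘ u) :=
    FunctionSpaces.EuclideanSpace.complexify.toContinuousLinearMap.integrable_comp hu
  unfold fourierVec
  rw [fourier_apply_coord hci, fourier_apply_coord hci, Real.fourier_eq, Real.fourier_eq,
    ← integral_conj]
  refine integral_congr_ae (Eventually.of_forall fun x => ?_)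
  simp only [Function.comp_apply, FunctionSpaces.EuclideanSpace.complexify_apply,
    Circle.smul_def, smul_eq_mul, map_mul, Complex.conj_ofReal, Circle.starRingEnd_addChar,
    inner_neg_right, neg_neg]

/-- **Conjugation symmetry of the Leray symbol**: `P̂(-ξ) c̄ = conj (P̂(ξ) c)` coordinatewise
(`P̂` has real entries and is even in `ξ`). [folklore] -/
theorem leraySymbolC_neg_conj_apply (ξ : EuclideanSpace ℝ ι) (c c' : EuclideanSpace ℂ ι)
    (hc : ∀ j, c' j = conj (c j)) (i : ι) :
    leraySymbolC (-ξ) c' i = conj (leraySymbolC ξ c i) := by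
  unfold leraySymbolC
  simp only [PiLp.sub_apply, PiLp.smul_apply, smul_eq_mul, map_sub, map_mul, map_div₀,
    map_sum, Complex.conj_ofReal, FunctionSpaces.EuclideanSpace.complexify_apply, hc,
    PiLp.neg_apply, norm_neg, Complex.ofReal_neg, map_neg]
  ring_nf
  rw [Finset.sum_neg_distrib]
  ring

/-- **The Leray symbol of a real field is Hermitian**:
`P̂(-ξ) ŵ(-ξ)ᵢ = conj (P̂(ξ) ŵ(ξ)ᵢ)` for an integrable real field `w`. [folklore] -/
theorem leraySymbolC_fourierVec_neg {w : EuclideanSpace ℝ ι → EuclideanSpace ℝ ι} (hw : Integrable w)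
    (ξ : EuclideanSpace ℝ ι) (i : ι) :
    leraySymbolC (-ξ) (fourierVec w (-ξ)) i = conj (leraySymbolC ξ (fourierVec w ξ) i) :=
  leraySymbolC_neg_conj_apply ξ _ _ (fun j => fourierVec_neg_apply hw ξ j) i

/-- **Coordinates pass through the inverse Fourier integral**: `(𝓕⁻ G x)ᵢ = 𝓕⁻ Gᵢ x` for
integrable `G : ℝ^ι → ℂ^ι`. [folklore] -/
theorem fourierInv_apply_coord {G : EuclideanSpace ℝ ι → EuclideanSpace ℂ ι} (hG : Integrable G)
    (x : EuclideanSpace ℝ ι) (i : ι) :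
    𝓕⁻ G x i = 𝓕⁻ (fun ξ => G ξ i) x := by
  rw [Real.fourierInv_eq_fourier_neg, Real.fourierInv_eq_fourier_neg, fourier_apply_coord hG]

/-- **A Hermitian symbol has a real kernel**: if `G ∈ L¹(ℝ^ι; ℂ^ι)` satisfies
`G(-ξ)ᵢ = conj G(ξ)ᵢ`, then `conj (𝓕⁻ G x)ᵢ = (𝓕⁻ G x)ᵢ` (conjugate under the integral and
substitute `ξ ↦ -ξ`). Tao 2016, §1.1 ("then `m(D)` maps `H¹⁰_df(ℝ³)` to itself"). [folklore] -/
theorem conj_fourierInv_apply_coord {G : EuclideanSpace ℝ ι → EuclideanSpace ℂ ι}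
    (hG : Integrable G)
    (hsymm : ∀ ξ i, G (-ξ) i = conj (G ξ i)) (x : EuclideanSpace ℝ ι) (i : ι) :
    conj (𝓕⁻ G x i) = 𝓕⁻ G x i := by
  rw [fourierInv_apply_coord hG, Real.fourierInv_eq, ← integral_conj]
  rw [← integral_neg_eq_self
    (fun ξ : EuclideanSpace ℝ ι => (𝐞 ⟪ξ, x⟫ : Circle) • G ξ i) volume]
  refine integral_congr_ae (Eventually.of_forall fun ξ => ?_)
  simp only [Circle.smul_def, smul_eq_mul, map_mul, Circle.starRingEnd_addChar, hsymm,
    inner_neg_left]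

/-- **Hence the kernel is fixed by `complexify ∘ realPart`**: `(Re 𝓕⁻ G x)ℂ = 𝓕⁻ G x`.
[folklore] -/
theorem complexify_realPart_fourierInv {G : EuclideanSpace ℝ ι → EuclideanSpace ℂ ι}
    (hG : Integrable G)
    (hsymm : ∀ ξ i, G (-ξ) i = conj (G ξ i)) (x : EuclideanSpace ℝ ι) :
    FunctionSpaces.EuclideanSpace.complexify (realPart (𝓕⁻ G x)) = 𝓕⁻ G x := by
  ext i
  rw [FunctionSpaces.EuclideanSpace.complexify_apply, realPart_apply]
  exact Complex.conj_eq_iff_re.1 (conj_fourierInv_apply_coord hG hsymm x i)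

end Reality

/-! ### `𝓕⁻[P̂ ŵ] ∈ L¹ ∩ C⁰` -/

section Kernel

variable [Nonempty ι]

omit [Nonempty ι] in
/-- `𝓕⁻ (M • v) = (𝓕⁻ M) • v` for a scalar function `M` and a constant vector `v`. [folklore] -/
theorem fourierInv_smul_const (M : EuclideanSpace ℝ ι → ℂ) (v : EuclideanSpace ℂ ι)
    (x : EuclideanSpace ℝ ι) :
    𝓕⁻ (fun ξ => M ξ • v) x = 𝓕⁻ M x • v := by
  rw [Real.fourierInv_eq, Real.fourierInv_eq, ← integral_smul_const]
  refine integral_congr_ae (Eventually.of_forall fun ξ => ?_)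
  dsimp only
  rw [Circle.smul_def, Circle.smul_def, smul_eq_mul, smul_smul]

/-- **The kernel of the Leray symbol on `ŵ`, `w = (u·∇)v + (v·∇)u`**: for divergence-free
Schwartz fields `U V` on `ℝ^ι`, with `w = (U·∇)V + (V·∇)U` and `G(ξ) = P̂(ξ) ŵ(ξ)`:
`G ∈ L¹`, `G` is continuous off the origin, and `𝓕⁻ G ∈ L¹ ∩ C⁰`
(`𝓕⁻ G = wℂ + ∑ₖ (𝓕⁻ M_k) e_k` with `EulerBilinearSymbol.exists_leraySymbolC_fourier_repr` and
`HeatSubordinatedRiesz.integrable_fourierInv_fourier_sum_lineDeriv₃_div_normSq`). [folklore] -/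
theorem leray_fourierVec_convect_regular (U V : 𝓢(EuclideanSpace ℝ ι, EuclideanSpace ℝ ι))
    (hU : VectorCalculus.IsDivFree (⇑U))
    (hV : VectorCalculus.IsDivFree (⇑V)) :
    let w : EuclideanSpace ℝ ι → EuclideanSpace ℝ ι :=
      fun x => convect (⇑U) (⇑V) x + convect (⇑V) (⇑U) x
    let G : EuclideanSpace ℝ ι → EuclideanSpace ℂ ι := fun ξ => leraySymbolC ξ (fourierVec w ξ)
    Integrable w ∧ Integrable G ∧ ContinuousOn G {0}ᶜ ∧ Integrable (𝓕⁻ G) ∧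
      Continuous (𝓕⁻ G) := by
  classical
  intro w G
  obtain ⟨W, g, hWcoe, hg, hP⟩ := exists_leraySymbolC_fourier_repr U V hU hV
  -- `wℂ = W`
  have hcw : FunctionSpaces.EuclideanSpace.complexify ∘ w = ⇑W := by
    rw [hWcoe]; rfl
  have hw : Integrable w := by
    have h1 : Integrable (FunctionSpaces.EuclideanSpace.complexify ∘ w) := hcw ▸ W.integrable
    refine h1.norm.mono' ?_ (Eventually.of_forall fun x => ?_)
    · have hc : Continuous w := by
        rw [← FunctionSpaces.EuclideanSpace.complexify.isometry.comp_continuous_iff, hcw]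
        exact W.continuous
      exact hc.aestronglyMeasurable
    · simp [Function.comp_apply]
  have hFw : fourierVec w = 𝓕 (⇑W) := by
    unfold fourierVec; rw [hcw]
  -- the multipliers `M_k`
  set M : ι → EuclideanSpace ℝ ι → ℂ :=
    fun k ξ => 𝓕 (⇑(g k)) ξ / (((2 * π) ^ 2 * ‖ξ‖ ^ 2 : ℝ) : ℂ) with hM
  have hMk : ∀ k, Integrable (M k) ∧ Integrable (𝓕⁻ (M k)) ∧ Continuous (𝓕⁻ (M k)) := by
    intro k
    obtain ⟨S, hS⟩ := hg k
    exact integrable_fourierInv_fourier_sum_lineDeriv₃_div_normSq Finset.univ S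
      (fun _ => EuclideanSpace.single k (1 : ℝ)) (fun m => EuclideanSpace.single m.1 (1 : ℝ))
      (fun m => EuclideanSpace.single m.2 (1 : ℝ)) (g k) hS
  -- `G = 𝓕 W + ∑ M_k e_k`
  have hGeq : G = fun ξ => 𝓕 (⇑W) ξ + ∑ k, M k ξ • EuclideanSpace.single k (1 : ℂ) := by
    funext ξ
    change leraySymbolC ξ (fourierVec w ξ) = _
    rw [hFw, hP ξ]
  have hFW : Integrable (𝓕 (⇑W)) := by
    rw [← SchwartzMap.fourier_coe]; exact (𝓕 W).integrable
  have hsum : Integrable (fun ξ => ∑ k, M k ξ • EuclideanSpace.single k (1 : ℂ)) :=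
    integrable_finsetSum _ fun k _ => (hMk k).1.smul_const _
  have hGi : Integrable G := by
    rw [hGeq]; exact hFW.add hsum
  -- continuity off the origin
  have hGc : ContinuousOn G {0}ᶜ := by
    rw [hGeq]
    refine ContinuousOn.add ?_ (continuousOn_finsetSum Finset.univ fun k _ => ?_)
    · rw [← SchwartzMap.fourier_coe]; exact (𝓕 W).continuous.continuousOn
    · have hnum : Continuous (𝓕 (⇑(g k))) := by
        rw [← SchwartzMap.fourier_coe]; exact (𝓕 (g k)).continuous
      have hden : Continuous fun ξ : EuclideanSpace ℝ ι => (((2 * π) ^ 2 * ‖ξ‖ ^ 2 : ℝ) : ℂ) := by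
        fun_prop
      have hMc : ContinuousOn (M k) {0}ᶜ := by
        refine hnum.continuousOn.div hden.continuousOn fun ξ hξ => ?_
        have hξ' : ξ ≠ 0 := hξ
        have hpos : 0 < (2 * π) ^ 2 * ‖ξ‖ ^ 2 := by
          have := norm_pos_iff.2 hξ'
          positivity
        exact Complex.ofReal_ne_zero.2 hpos.ne'
      exact hMc.smul continuousOn_const
  -- the kernel `𝓕⁻ G = W + ∑ (𝓕⁻ M_k) e_k`
  have hL : Continuous fun p : EuclideanSpace ℝ ι × EuclideanSpace ℝ ι =>
      (-innerₗ (EuclideanSpace ℝ ι)) p.1 p.2 := continuous_inner.neg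
  have hKer : 𝓕⁻ G = fun x => W x + ∑ k, 𝓕⁻ (M k) x • EuclideanSpace.single k (1 : ℂ) := by
    rw [hGeq]
    have hadd := VectorFourier.fourierIntegral_add Real.continuous_fourierChar hL hFW hsum
    change VectorFourier.fourierIntegral 𝐞 volume (-innerₗ (EuclideanSpace ℝ ι))
      ((𝓕 (⇑W)) + fun ξ => ∑ k, M k ξ • EuclideanSpace.single k (1 : ℂ)) = _
    rw [hadd]
    have h1 : VectorFourier.fourierIntegral 𝐞 volume (-innerₗ (EuclideanSpace ℝ ι)) (𝓕 (⇑W)) =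
        ⇑W :=
      W.continuous.fourierInv_fourier_eq W.integrable hFW
    have h2 : (fun ξ : EuclideanSpace ℝ ι => ∑ k, M k ξ • EuclideanSpace.single k (1 : ℂ)) =
        ∑ k, fun ξ : EuclideanSpace ℝ ι => M k ξ • EuclideanSpace.single k (1 : ℂ) := by
      funext ξ; simp
    have h3 : VectorFourier.fourierIntegral 𝐞 volume (-innerₗ (EuclideanSpace ℝ ι))
        (fun ξ : EuclideanSpace ℝ ι => ∑ k, M k ξ • EuclideanSpace.single k (1 : ℂ)) =
        fun x => ∑ k, 𝓕⁻ (M k) x • EuclideanSpace.single k (1 : ℂ) := by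
      rw [h2]
      change 𝓕⁻ (∑ k, fun ξ : EuclideanSpace ℝ ι =>
        M k ξ • EuclideanSpace.single k (1 : ℂ)) = _
      rw [fourierInv_finset_sum Finset.univ fun k _ => (hMk k).1.smul_const _]
      funext x
      rw [Finset.sum_apply]
      exact Finset.sum_congr rfl fun k _ => fourierInv_smul_const (M k) _ x
    rw [h1, h3]
    rfl
  refine ⟨hw, hGi, hGc, ?_, ?_⟩
  · rw [hKer]
    exact W.integrable.add (integrable_finsetSum _ fun k _ => (hMk k).2.1.smul_const _)
  · rw [hKer]
    exact W.continuous.add (continuous_finsetSum _ fun k _ => (hMk k).2.2.smul continuous_const)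

end Kernel

/-! ### `B(u,v) ∈ L¹ ∩ C⁰` with `𝓕 Bℂ ∈ L¹`, and `1(D) B = B` -/

section Main

variable [Nonempty ι]

/-- **Regularity of the Euler bilinear operator of Schwartz divergence-free fields**:
`B(u,v) = eulerBilinear u v` is continuous and integrable, and the Fourier transform of its
complexification is integrable (so that the function-level multipliers `m(D)` of
`TaoAveragedEuler.lean` are honest on it). `B = -½ Re 𝓕⁻G` with `G = P̂ ŵ ∈ L¹`,
`𝓕⁻G ∈ L¹ ∩ C⁰` real (`leray_fourierVec_convect_regular`, `complexify_realPart_fourierInv`), and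
`𝓕𝓕⁻G = G` a.e. (Fourier inversion at the continuity points `ξ ≠ 0` of `G`). Tao 2016, §1.1
(`B : H¹⁰_df × H¹⁰_df → H¹⁰_df*`; here the Schwartz case). [folklore] -/
theorem eulerBilinear_regular {u v : EuclideanSpace ℝ ι → EuclideanSpace ℝ ι} (hu : IsSchwartzField u)
    (hv : IsSchwartzField v)
    (hdu : VectorCalculus.IsDivFree u) (hdv : VectorCalculus.IsDivFree v) :
    Continuous (eulerBilinear u v) ∧ Integrable (eulerBilinear u v) ∧
      Integrable (fourierVec (eulerBilinear u v)) := by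
  obtain ⟨U, rfl⟩ := hu
  obtain ⟨V, rfl⟩ := hv
  obtain ⟨hw, hGi, hGc, hKi, hKc⟩ := leray_fourierVec_convect_regular U V hdu hdv
  set w : EuclideanSpace ℝ ι → EuclideanSpace ℝ ι :=
    fun x => convect (⇑U) (⇑V) x + convect (⇑V) (⇑U) x with hw_def
  set G : EuclideanSpace ℝ ι → EuclideanSpace ℂ ι := fun ξ => leraySymbolC ξ (fourierVec w ξ) with hG_def
  have hsymm : ∀ ξ i, G (-ξ) i = conj (G ξ i) := fun ξ i =>
    leraySymbolC_fourierVec_neg hw ξ i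
  -- `Bℂ = -½ 𝓕⁻ G`
  have hB : eulerBilinear (⇑U) (⇑V) = fun x => -(2 : ℝ)⁻¹ • realPart (𝓕⁻ G x) := by
    funext x
    simp only [eulerBilinear, lerayProjFun, Pi.smul_apply]
    rfl
  have hBc : (FunctionSpaces.EuclideanSpace.complexify ∘ eulerBilinear (⇑U) (⇑V)) =
      fun x => ((-(2 : ℝ)⁻¹ : ℝ) : ℂ) • 𝓕⁻ G x := by
    funext x
    rw [Function.comp_apply, hB]
    dsimp only
    rw [FunctionSpaces.EuclideanSpace.complexify.map_smul,
      complexify_realPart_fourierInv hGi hsymm x,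
      Complex.coe_smul]
  -- continuity
  have hcont : Continuous (eulerBilinear (⇑U) (⇑V)) := by
    rw [← FunctionSpaces.EuclideanSpace.complexify.isometry.comp_continuous_iff, hBc]
    exact hKc.const_smul (((-(2 : ℝ)⁻¹ : ℝ) : ℂ))
  -- integrability
  have hint : Integrable (eulerBilinear (⇑U) (⇑V)) := by
    have h1 :
        Integrable (FunctionSpaces.EuclideanSpace.complexify ∘ eulerBilinear (⇑U) (⇑V)) := by
      rw [hBc]; exact hKi.smul (((-(2 : ℝ)⁻¹ : ℝ) : ℂ))
    refine h1.norm.mono' hcont.aestronglyMeasurable (Eventually.of_forall fun x => ?_)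
    simp [Function.comp_apply]
  refine ⟨hcont, hint, ?_⟩
  -- `𝓕 Bℂ = -½ 𝓕𝓕⁻G = -½ G` a.e.
  have hFG : Integrable (𝓕 G) := by
    have h : 𝓕 G = fun ξ => 𝓕⁻ G (-ξ) := by
      funext ξ; rw [Real.fourierInv_eq_fourier_neg, neg_neg]
    rw [h]; exact hKi.comp_neg
  have hae : ∀ᵐ ξ : EuclideanSpace ℝ ι ∂volume, ξ ≠ 0 :=
    compl_mem_ae_iff.mpr (measure_singleton (0 : EuclideanSpace ℝ ι))
  have hinv : 𝓕 (𝓕⁻ G) =ᵐ[volume] G := by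
    filter_upwards [hae] with ξ hξ
    exact hGi.fourier_fourierInv_eq hFG (hGc.continuousAt (isOpen_compl_singleton.mem_nhds hξ))
  have hFFG : Integrable (𝓕 (𝓕⁻ G)) := hGi.congr hinv.symm
  have hF : fourierVec (eulerBilinear (⇑U) (⇑V)) =
      fun ξ => ((-(2 : ℝ)⁻¹ : ℝ) : ℂ) • 𝓕 (𝓕⁻ G) ξ := by
    unfold fourierVec
    rw [hBc]
    change VectorFourier.fourierIntegral 𝐞 volume (innerₗ (EuclideanSpace ℝ ι))
      (((-(2 : ℝ)⁻¹ : ℝ) : ℂ) • 𝓕⁻ G) = _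
    rw [VectorFourier.fourierIntegral_const_smul]
    rfl
  rw [hF]
  exact hFFG.smul (((-(2 : ℝ)⁻¹ : ℝ) : ℂ))

omit [Nonempty ι] in
/-- **`1(D) u = u` for a Schwartz field** (`u ∈ L¹ ∩ C⁰`, `𝓕 uℂ` Schwartz hence integrable;
the tree's `multiplierApply_one`). [folklore] -/
theorem multiplierApply_one_of_isSchwartzField {u : EuclideanSpace ℝ ι → EuclideanSpace ℝ ι}
    (hu : IsSchwartzField u) :
    multiplierApply (fun _ => 1) u = u := by
  obtain ⟨U, rfl⟩ := hu
  have hc :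
      (FunctionSpaces.EuclideanSpace.complexify ∘ ⇑U : EuclideanSpace ℝ ι → EuclideanSpace ℂ ι) =
      ⇑(SchwartzMap.postcompCLM (𝕜 := ℝ)
        (LinearIsometry.toContinuousLinearMap FunctionSpaces.EuclideanSpace.complexify) U) :=
    funext fun x => by rw [Function.comp_apply, SchwartzMap.postcompCLM_apply]; rfl
  refine multiplierApply_one U.continuous U.integrable ?_
  unfold fourierVec
  rw [hc, ← SchwartzMap.fourier_coe]
  exact SchwartzMap.integrable _

/-- **`1(D) B(u,v) = B(u,v)`** for Schwartz divergence-free `u v`: the function-level trivial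
multiplier is the identity on the Euler bilinear operator (`eulerBilinear_regular` and the
tree's `multiplierApply_one`). This is the analytic content of "the Euler bilinear operator `B`
is itself an averaged Euler bilinear operator" (Tao 2016, §1.1, the case `mᵢ ≡ 1`, `Rᵢ = 1`,
`λᵢ = 1` of (1.12)). [folklore] -/
theorem multiplierApply_one_eulerBilinear {u v : EuclideanSpace ℝ ι → EuclideanSpace ℝ ι}
    (hu : IsSchwartzField u)
    (hv : IsSchwartzField v) (hdu : VectorCalculus.IsDivFree u)
    (hdv : VectorCalculus.IsDivFree v) :
    multiplierApply (fun _ => 1) (eulerBilinear u v) = eulerBilinear u v := by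
  obtain ⟨h1, h2, h3⟩ := eulerBilinear_regular hu hv hdu hdv
  exact multiplierApply_one h1 h2 h3

end Main

/-! ### The trivial averaging datum and the discharge (`ℝ³`) -/

section Datum

/-- **The constant symbol `1` is a symbol of order `0`** (Tao 2016, §1.1: `∇ʲ1 = 0` for
`j ≥ 1`). [folklore] -/
theorem isOrderZeroSymbol_one :
    IsOrderZeroSymbol (fun _ : EuclideanSpace ℝ (Fin 3) => (1 : ℝ)) := by
  refine ⟨contDiffOn_const, fun j => ⟨1, fun ξ _ => ?_⟩⟩
  rcases Nat.eq_zero_or_pos j with rfl | hj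
  · simp
  · rw [iteratedFDeriv_const_of_ne (𝕜 := ℝ) hj.ne' (1 : ℝ)]
    simp only [Pi.zero_apply, norm_zero]
    positivity

/-- **The trivial averaging datum** `Ω = {pt}`, `mᵢ ≡ 1`, `Rᵢ = 1`, `λᵢ = 1`, `σ = 3/2`
(Tao 2016, §1.1, the deterministic case of (1.12)), as a term (no new definition: it is only
used inside the discharge below). [folklore] -/
theorem exists_trivial_taoAverageData :
    ∃ 𝒜 : TaoAverageData, ∀ u v : EuclideanSpace ℝ (Fin 3) → EuclideanSpace ℝ (Fin 3),
      𝒜.op u v =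
        multiplierApply (fun _ => 1)
          (eulerBilinear (multiplierApply (fun _ => 1) u) (multiplierApply (fun _ => 1) v)) := by
  let 𝒜 : TaoAverageData :=
    { Ω := Unit
      P := Measure.dirac ()
      σ := 3 / 2
      m := fun _ _ _ => 1
      R := fun _ _ => LinearIsometryEquiv.refl ℝ (EuclideanSpace ℝ (Fin 3))
      lam := fun _ _ => 1
      isOrderZeroSymbol := fun _ _ => isOrderZeroSymbol_one
      lam_pos := fun _ _ => one_pos
      measurable_m := fun _ => measurable_const
      measurable_R := fun _ => measurable_snd
      measurable_lam := fun _ => measurable_const }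
  have hdil : ∀ w : EuclideanSpace ℝ (Fin 3) → EuclideanSpace ℝ (Fin 3),
      dilateField (3 / 2 : ℝ) 1 w = w := fun w => by
    funext y
    simp [dilateField, Real.one_rpow]
  have hslot : ∀ (i : Fin 3) (w : EuclideanSpace ℝ (Fin 3) → EuclideanSpace ℝ (Fin 3)),
      𝒜.slot i () w = multiplierApply (fun _ => 1) w := by
    intro i w
    change multiplierApply (fun _ => 1)
      (rotateField (LinearIsometryEquiv.refl ℝ (EuclideanSpace ℝ (Fin 3)))
        (dilateField (3 / 2 : ℝ) 1 w)) = _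
    rw [hdil]
    rfl
  have hadj : ∀ w : EuclideanSpace ℝ (Fin 3) → EuclideanSpace ℝ (Fin 3),
      𝒜.slotAdjoint 2 () w = multiplierApply (fun _ => 1) w := by
    intro w
    change (1 : ℝ) ^ (2 * (3 / 2 : ℝ) - 3) • dilateField (3 / 2 : ℝ) (1 : ℝ)⁻¹
      (rotateField (LinearIsometryEquiv.refl ℝ (EuclideanSpace ℝ (Fin 3))).symm
        (multiplierApply (fun _ => 1) w)) = _
    rw [Real.one_rpow, one_smul, inv_one, hdil]
    rfl
  refine ⟨𝒜, fun u v => ?_⟩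
  funext x
  change ∫ θ, 𝒜.slotAdjoint 2 θ (eulerBilinear (𝒜.slot 0 θ u) (𝒜.slot 1 θ v)) x
    ∂(Measure.dirac ()) = _
  rw [integral_dirac, hslot, hslot, hadj]

/-- **Discharge of `exists_taoAverageData_op_eq_eulerBilinear`: the Euler bilinear operator `B`
is itself an averaged Euler bilinear operator** on Schwartz divergence-free fields (Tao 2016,
§1.1, the deterministic datum `mᵢ ≡ 1`, `Rᵢ = 1`, `λᵢ = 1` of (1.12): `𝒜.op u v = 1(D) B(1(D)u,
1(D)v) = B(u,v)`, using `1(D)u = u` for Schwartz `u` and `1(D)B(u,v) = B(u,v)`, the latter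
because `B(u,v) ∈ L¹ ∩ C⁰` with integrable Fourier transform, `EulerBilinearIntegrable.lean`).
[cite: Tao2016, §1.1 Def. of averaged Euler bilinear operator (1.12)] -/
theorem exists_taoAverageData_op_eq_eulerBilinear_holds :
    exists_taoAverageData_op_eq_eulerBilinear := by
  obtain ⟨𝒜, h𝒜⟩ := exists_trivial_taoAverageData
  refine ⟨𝒜, fun u v hu hv hdu hdv => ?_⟩
  rw [h𝒜, multiplierApply_one_of_isSchwartzField hu, multiplierApply_one_of_isSchwartzField hv,
    multiplierApply_one_eulerBilinear hu hv hdu hdv]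

end Datum

end Literature.Analysis.FluidPDE
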